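import Summits.CriticalPhenomena.CardyFormulaZ2.Theses.CardySelfDualSegment
import Summits.CriticalPhenomena.CardyFormulaZ2.Theorems.CardySelfDualSegmentUniformMarginalityWildFromRectilinear
import HarnessLib

/-!
# `SegmentOpen` from confinement rigidity (analyticity-free decomposition D1, glue only)

Route `CardySelfDualSegment` of `CriticalPhenomena/CardyFormulaZ2`, crux `SegmentOpen`
(stmt-CriticalPhenomena-5471): `UniformMarginality → IsOpen G`,
`G = {t ∈ [0,1] | ∃ α, 0 < Im α ∧ CardyMod t α}`.

The live line `Sketch` reaches the crux through mesh-uniform ANALYTICITY of the crossing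
polynomials in `t` (stubs S4wR / JCR / JIR), with the marginality hypothesis idle. The crux
strategist's census (`Cruxes/SegmentOpen/STRATEGY-CENSUS.md`, decomposition D1; workfile
`Cruxes/SegmentOpen/Contingency_confinement_rigidity.lean`) records the one reformulation that uses
no analyticity, no jets and no rate at the Smirnov point, and in which marginality is LOAD-BEARING
(it supplies the confinement; compare `Disproof.not_isOpen_goodSet_of_marginal_family`):

* (R3) ISOLATION — near a modulus `α₀` that is the sheared-Cardy modulus of some `M_{t₀}`, every corner
  model whose crossing probabilities are `ε₀`-confined (eventually in the mesh) near the `α₀`-sheared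
  Cardy values on a finite test family has, along every mesh sequence, a subsequence with sheared-Cardy
  limits on all rectilinear test domains for ONE modulus `α ∈ ℍ`;
* (R4) ASYMPTOTIC PHASE — if every mesh sequence has such a subsequence then one modulus serves and the
  full limits `δ → 0⁺` exist on rectilinear test domains.

This file lands the COMPOSITION as a theorem of the tree (the strategist seat cannot write under
`Theorems/`): `segmentOpen_of_confinementRigidity : (R3) → (R4) → SegmentOpen`, both rigidity
statements being explicit hypotheses (research-grade, NOT claimed; no known attack — they are implied
by the route's `Target` and do not imply it). Ingredients: `ConfinementRigidity.eventually_confined`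
(marginality ⇒ confinement near a good point: `eventually_all_finset` + `ε/2`) and the landed
rectilinear-to-wild transport (W) `HeatFlow.cardyLimit_of_rectilinear` (p137344). So the crux has
exactly two typed decompositions in the tree — `Sketch` (analytic; kernel K = order-1 marginality) and
this one (toolless rigidity) — which is the record behind lead c7's decision to park the item.

References: V. Beffara, *Is critical 2D percolation universal?*, Progr. Probab. 60 (2008), §2;
O. Schramm, S. Smirnov, *On the scaling limits of planar percolation*, Ann. Probab. 39 (2011), §1
(subsequential limits); F. Camia, C. M. Newman, *Two-dimensional critical percolation: the full
scaling limit*, Comm. Math. Phys. 268 (2006) (uniqueness of the limit).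
-/

namespace Summit.CriticalPhenomena.CardyFormulaZ2.Theorems

open Filter Set Topology
open Literature.Probability Literature.Barriers.CriticalPhenomena
open Literature.Probability.RandomPlanarGeometry (ConformalRectangle ConformalEquiv cardyFunction
  crossRatio)
open UpperHalfPlane (upperHalfPlaneSet)

/-- **Confinement from marginality** (soft): if `M_{t₀}` has `α₀`-sheared Cardy limits and the
crossing probabilities are equicontinuous in `t` uniformly in the mesh (the crux hypothesis, over
`cornerCrossingProb`), then for `t` near `t₀` the crossing probabilities of `M_t` are eventually (in the
mesh) `ε`-close to the `α₀`-sheared Cardy values on any finite test family `F`. Proof: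
`eventually_all_finset` over `F` with `ε/2`, plus the limit at `t₀` with `ε/2`. (Adapted from the
strategist workfile `Contingency_confinement_rigidity.lean`.) [folklore] -/
theorem ConfinementRigidity.eventually_confined
    (hUM : ∀ (t₀ : unitInterval) (R : ConformalRectangle) (ε : ℝ), 0 < ε → ∃ η > 0,
      ∀ t : unitInterval, dist t t₀ < η → ∀ δ : ℝ, 0 < δ →
        |Percolation.cornerCrossingProb t R δ - Percolation.cornerCrossingProb t₀ R δ| < ε)
    {t₀ : unitInterval} {α₀ : ℂ}
    (hC₀ : ∀ (R R' : ConformalRectangle) (φ : ConformalEquiv upperHalfPlaneSet R.carrier)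
      (x : Fin 4 → ℝ),
      R.carrier = moduliShear α₀ '' R'.carrier → (∀ i, R.pt i = moduliShear α₀ (R'.pt i)) →
      R.IsUniformizing φ x →
      Tendsto (Percolation.cornerCrossingProb t₀ R') (𝓝[>] 0) (𝓝 (cardyFunction (crossRatio x))))
    {ε : ℝ} (hε : 0 < ε) (F : Finset ConformalRectangle) :
    ∀ᶠ t in 𝓝 t₀, ∀ R' ∈ F, ∀ (R : ConformalRectangle)
      (φ : ConformalEquiv upperHalfPlaneSet R.carrier) (x : Fin 4 → ℝ),
      R.carrier = moduliShear α₀ '' R'.carrier → (∀ i, R.pt i = moduliShear α₀ (R'.pt i)) →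
      R.IsUniformizing φ x →
      ∀ᶠ δ in 𝓝[>] (0 : ℝ),
        |Percolation.cornerCrossingProb t R' δ - cardyFunction (crossRatio x)| < ε := by
  -- adapted from Cruxes/SegmentOpen/Contingency_confinement_rigidity.lean (strategist s2)
  have hnear : ∀ᶠ t in 𝓝 t₀, ∀ R' ∈ F, ∀ δ : ℝ, 0 < δ →
      |Percolation.cornerCrossingProb t R' δ - Percolation.cornerCrossingProb t₀ R' δ| < ε / 2 := by
    rw [eventually_all_finset]
    intro R' _
    obtain ⟨η, hη, h⟩ := hUM t₀ R' (ε / 2) (by positivity)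
    exact Metric.eventually_nhds_iff.2 ⟨η, hη, fun t ht => h t ht⟩
  filter_upwards [hnear] with t ht
  intro R' hR' R φ x hc hp hu
  have h₀ : ∀ᶠ δ in 𝓝[>] (0 : ℝ),
      dist (Percolation.cornerCrossingProb t₀ R' δ) (cardyFunction (crossRatio x)) < ε / 2 :=
    Metric.tendsto_nhds.1 (hC₀ R R' φ x hc hp hu) (ε / 2) (by positivity)
  have hpos : ∀ᶠ δ in 𝓝[>] (0 : ℝ), δ ∈ Ioi (0 : ℝ) := eventually_mem_nhdsWithin
  filter_upwards [h₀, hpos] with δ hδ hδpos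
  have h1 := ht R' hR' δ hδpos
  rw [Real.dist_eq] at hδ
  calc |Percolation.cornerCrossingProb t R' δ - cardyFunction (crossRatio x)|
      = |(Percolation.cornerCrossingProb t R' δ - Percolation.cornerCrossingProb t₀ R' δ) +
          (Percolation.cornerCrossingProb t₀ R' δ - cardyFunction (crossRatio x))| := by ring_nf
    _ ≤ |Percolation.cornerCrossingProb t R' δ - Percolation.cornerCrossingProb t₀ R' δ| +
          |Percolation.cornerCrossingProb t₀ R' δ - cardyFunction (crossRatio x)| := abs_add_le _ _
    _ < ε / 2 + ε / 2 := add_lt_add h1 hδ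
    _ = ε := by ring

/-- **`SegmentOpen` from confinement rigidity** (decomposition D1 of the strategist census, glue
only): (R3) ISOLATION → (R4) ASYMPTOTIC PHASE → the route decl `SegmentOpen`, BY NAME. Both
rigidity statements are explicit hypotheses (research-grade, not claimed). Proof: near a good point
`t₀` (modulus `α₀`) marginality confines every `M_t` (`ConfinementRigidity.eventually_confined`);
(R3) extracts sheared-Cardy subsequential limits on rectilinear test domains, (R4) makes them full
limits with one modulus, and the landed transport (W) `HeatFlow.cardyLimit_of_rectilinear` upgrades
rectilinear test domains to all conformal rectangles; so the good set is a neighbourhood of each of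
its points. [folklore] -/
theorem segmentOpen_of_confinementRigidity :
    (∀ α₀ : ℂ, 0 < α₀.im →
      (∃ t₀ : unitInterval, ∀ (R R' : ConformalRectangle)
          (φ : ConformalEquiv upperHalfPlaneSet R.carrier) (x : Fin 4 → ℝ),
          R.carrier = moduliShear α₀ '' R'.carrier → (∀ i, R.pt i = moduliShear α₀ (R'.pt i)) →
          R.IsUniformizing φ x →
          Tendsto (Percolation.cornerCrossingProb t₀ R') (𝓝[>] 0)
            (𝓝 (cardyFunction (crossRatio x)))) →
      ∃ ε₀ > 0, ∃ F : Finset ConformalRectangle, ∀ t : unitInterval,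
        (∀ R' ∈ F, ∀ (R : ConformalRectangle) (φ : ConformalEquiv upperHalfPlaneSet R.carrier)
            (x : Fin 4 → ℝ),
            R.carrier = moduliShear α₀ '' R'.carrier → (∀ i, R.pt i = moduliShear α₀ (R'.pt i)) →
            R.IsUniformizing φ x →
            ∀ᶠ δ in 𝓝[>] (0 : ℝ),
              |Percolation.cornerCrossingProb t R' δ - cardyFunction (crossRatio x)| < ε₀) →
        ∀ δs : ℕ → ℝ, (∀ k, 0 < δs k) → Tendsto δs atTop (𝓝 0) →
          ∃ ψ : ℕ → ℕ, StrictMono ψ ∧ ∃ α : ℂ, 0 < α.im ∧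
            ∀ R' : ConformalRectangle,
              (∃ S : Finset (ℂ × ℂ), (∀ p ∈ S, p.1.re = p.2.re ∨ p.1.im = p.2.im) ∧
                frontier R'.carrier ⊆ ⋃ p ∈ S, segment ℝ p.1 p.2) →
              ∀ (R : ConformalRectangle) (φ : ConformalEquiv upperHalfPlaneSet R.carrier)
                (x : Fin 4 → ℝ),
                R.carrier = moduliShear α '' R'.carrier → (∀ i, R.pt i = moduliShear α (R'.pt i)) →
                R.IsUniformizing φ x →
                Tendsto (fun k => Percolation.cornerCrossingProb t R' (δs (ψ k))) atTop
                  (𝓝 (cardyFunction (crossRatio x)))) →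
    (∀ t : unitInterval,
      (∀ δs : ℕ → ℝ, (∀ k, 0 < δs k) → Tendsto δs atTop (𝓝 0) →
          ∃ ψ : ℕ → ℕ, StrictMono ψ ∧ ∃ α : ℂ, 0 < α.im ∧
            ∀ R' : ConformalRectangle,
              (∃ S : Finset (ℂ × ℂ), (∀ p ∈ S, p.1.re = p.2.re ∨ p.1.im = p.2.im) ∧
                frontier R'.carrier ⊆ ⋃ p ∈ S, segment ℝ p.1 p.2) →
              ∀ (R : ConformalRectangle) (φ : ConformalEquiv upperHalfPlaneSet R.carrier)
                (x : Fin 4 → ℝ),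
                R.carrier = moduliShear α '' R'.carrier → (∀ i, R.pt i = moduliShear α (R'.pt i)) →
                R.IsUniformizing φ x →
                Tendsto (fun k => Percolation.cornerCrossingProb t R' (δs (ψ k))) atTop
                  (𝓝 (cardyFunction (crossRatio x)))) →
      ∃ α : ℂ, 0 < α.im ∧
        ∀ R' : ConformalRectangle,
          (∃ S : Finset (ℂ × ℂ), (∀ p ∈ S, p.1.re = p.2.re ∨ p.1.im = p.2.im) ∧
            frontier R'.carrier ⊆ ⋃ p ∈ S, segment ℝ p.1 p.2) →
          ∀ (R : ConformalRectangle) (φ : ConformalEquiv upperHalfPlaneSet R.carrier)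
            (x : Fin 4 → ℝ),
            R.carrier = moduliShear α '' R'.carrier → (∀ i, R.pt i = moduliShear α (R'.pt i)) →
            R.IsUniformizing φ x →
            Tendsto (Percolation.cornerCrossingProb t R') (𝓝[>] 0)
              (𝓝 (cardyFunction (crossRatio x)))) →
    Summit.CriticalPhenomena.CardyFormulaZ2.Theses.CardySelfDualSegment.SegmentOpen := by
  intro hI hP hUM
  refine isOpen_iff_mem_nhds.2 fun t₀ ht₀ => ?_
  obtain ⟨α₀, hα₀, hC₀⟩ := ht₀
  obtain ⟨ε₀, hε₀, F, hF⟩ := hI α₀ hα₀ ⟨t₀, hC₀⟩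
  filter_upwards [ConfinementRigidity.eventually_confined hUM hC₀ hε₀ F] with t ht
  obtain ⟨α, hα, hrect⟩ := hP t (hF t ht)
  exact ⟨α, hα, fun R R' φ x hc hp hu =>
    Summit.CriticalPhenomena.CardyFormulaZ2.Cruxes.UniformMarginality.HeatFlow.cardyLimit_of_rectilinear
      t α hα (fun R₁ R₁' φ₁ x₁ hrect₁ hc₁ hp₁ hu₁ => hrect R₁' hrect₁ R₁ φ₁ x₁ hc₁ hp₁ hu₁)
      R R' φ x hc hp hu⟩

end Summit.CriticalPhenomena.CardyFormulaZ2.Theorems
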